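import Mathlib
import HarnessLib
import Summits.Ventures.LatticeQCDFlow.Exactness.SUNMultiStepLeapfrogHMCEngine

/-!
# Any `C¹` force law on `SU(N)` lattice gauge fields is bounded and Lipschitz in the matrix sup norm: the engine's multi-step HMC converges for short trajectories with every smooth force

HONEST FRAMING: exact (Metropolis-corrected) sampling algorithms for lattice gauge theory;
figures of merit are autocorrelation/cost numbers at stated couplings and volumes; no
continuum-physics claim.

Venture `LatticeQCDFlow` (cell pub-lqcd), topic `Exactness`, FANOUT row 9 (eng-latcore, the
engine `latflow.core.hmc.HMC(f, β, 'leapfrog').trajectory(τ, nstep)` (4D) and `sun_2d.HMC2D` (2D) on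
`SU(N)`: half kicks `P ← P − c·F(U)` by a force ROUTINE `F` that is a polynomial in the link matrices
and their adjoints — the Wilson force `(β/2N)·TA(U_e R_e)` of `gauge4d.force`, and every improved /
smeared variant).  NEW WORK of the cell over Mathlib (`Convex.norm_image_sub_le_of_norm_fderiv_le`,
`ContDiff.continuous_fderiv`, compactness of closed balls in finite dimension) and the tree
(`SUNMultiStepLeapfrogHMCEngine.lean`: the trajectory-length theorem
`engine_sunLeapfrogHMCN_uniformlyErgodic_of_trajLength` for a force field bounded by `F_max` and
`K_F`-Lipschitz in the matrix sup norm; `SUNProductTrajectory.lean`: `coeConfig`, `‖coeConfig U‖ ≤ N`);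
nothing here is cited as a fact.

THE POINT.  GEN-18's convergence theorem for the engine's `n`-step leapfrog HMC asks of the force
field `F : SU(N)^links → (links → coordinates)` three things: measurable, bounded per link, Lipschitz in
the sup norm of the ambient matrix algebra `links → M_N(ℂ)`.  Every force the engine evaluates is the
restriction to the configurations of a map `P` of the AMBIENT algebra built from ring operations,
adjoints and linear coordinate maps — a `C¹` map.  The configurations sit in the closed ball of radius
`N` (`‖U‖_{∞-op} ≤ N` for `U ∈ SU(N)`), which is compact and convex, so `P` is bounded there and
Lipschitz with constant `sup ‖DP‖` (mean value inequality).  No constant is computed.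

* §1 `exists_bound_on_closedBall_of_continuous`, **`exists_lipschitz_on_closedBall_of_contDiff`** —
  a `C¹` map between real normed spaces, finite-dimensional source, is bounded and Lipschitz on every
  closed ball (constants exist; not computed).
* §2 **`sunForce_bounds_of_contDiff`** — for a `C¹` ambient law
  `P : (links → M_N(ℂ)) → (links → E)` the force `U ↦ P (coeConfig U)` is bounded per link and Lipschitz
  in the matrix sup norm with SOME `F_max, K_F ≥ 0`; `measurable_sunForce_of_continuous`.
* §3 **`engine_sunLeapfrogHMCN_uniformlyErgodic_of_contDiff`** — hence for EVERY `C¹` ambient force law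
  and every measurable action bounded by `s` there is `τ₀ > 0` such that every `n ≥ 1`, `ε > 0` with
  `nε ≤ τ₀` give a uniformly ergodic exact chain (the engine's coordinates, kinetic term `−Σ tr P²`,
  half kick `−(ε/2)·P(U)`): convergence to `Z_S⁻¹e^{−S}·Haar^{⊗links}` from every initial law,
  geometrically in total variation.

NOT CLAIMED: any value of `F_max`, `K_F`, `τ₀` (compactness and the inverse function theorem only);
anything beyond the threshold (the engine's usual `τ ≈ 1` is NOT covered); that a given routine IS the
gradient of its action (irrelevant for convergence; the Wilson routine is identified in the sequel
`SUNWilsonForce.lean`); OMF words; floating point.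
-/

noncomputable section

namespace Summit.Ventures.LatticeQCDFlow.Exactness

open MeasureTheory ProbabilityTheory ProbabilityTheory.Kernel Set Metric Function
open Literature.MathematicalPhysics.QuantumFieldTheory
open scoped ENNReal Matrix Matrix.Norms.Operator NNReal

set_option backward.isDefEq.respectTransparency false

/-! ## §1 A `C¹` map is bounded and Lipschitz on every closed ball -/

section Smooth

variable {V W : Type*} [NormedAddCommGroup V] [NormedSpace ℝ V] [FiniteDimensional ℝ V]
  [NormedAddCommGroup W]

/-- A continuous map on a finite-dimensional real normed space is bounded on every closed ball
(by a non-negative constant). -/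
theorem exists_bound_on_closedBall_of_continuous {P : V → W} (hP : Continuous P) (R : ℝ) :
    ∃ B : ℝ, 0 ≤ B ∧ ∀ x ∈ closedBall (0 : V) R, ‖P x‖ ≤ B := by
  obtain ⟨B, hB⟩ := (isCompact_closedBall (0 : V) R).exists_bound_of_continuousOn hP.continuousOn
  exact ⟨max B 0, le_max_right _ _, fun x hx => (hB x hx).trans (le_max_left _ _)⟩

/-- **A `C¹` map on a finite-dimensional real normed space is Lipschitz on every closed ball** (mean
value inequality on the convex ball with the constant `sup ‖DP‖`, which exists by compactness; not
computed). -/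
theorem exists_lipschitz_on_closedBall_of_contDiff [NormedSpace ℝ W] {P : V → W} (hP : ContDiff ℝ 1 P) (R : ℝ) :
    ∃ K : ℝ, 0 ≤ K ∧ ∀ x ∈ closedBall (0 : V) R, ∀ y ∈ closedBall (0 : V) R, ‖P x - P y‖ ≤ K * ‖x - y‖ := by
  obtain ⟨K, hK0, hK⟩ := exists_bound_on_closedBall_of_continuous (hP.continuous_fderiv one_ne_zero) R
  refine ⟨K, hK0, fun x hx y hy => ?_⟩
  exact (convex_closedBall (0 : V) R).norm_image_sub_le_of_norm_fderiv_le
    (fun z _ => (hP.differentiable one_ne_zero).differentiableAt) hK hy hx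

end Smooth

/-! ## §2 Forces that are restrictions of smooth ambient laws -/

section Config

variable {N : ℕ} {L : Type*} [Fintype L] {E : Type*} [NormedAddCommGroup E] [NormedSpace ℝ E]

/-- **For a `C¹` ambient law `P`, the force `U ↦ P (coeConfig U)` is bounded per link and Lipschitz in
the matrix sup norm** with some constants `F_max, K_F ≥ 0` (a configuration lies in the closed ball of
radius `N` of the ambient algebra, `norm_coeConfig_le`). -/
theorem sunForce_bounds_of_contDiff (P : (L → Matrix (Fin N) (Fin N) ℂ) → L → E) (hP : ContDiff ℝ 1 P) :
    ∃ Fmax KF : ℝ, 0 ≤ Fmax ∧ 0 ≤ KF ∧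
      (∀ (U : L → Matrix.specialUnitaryGroup (Fin N) ℂ) (l : L), ‖P (coeConfig U) l‖ ≤ Fmax) ∧
      ∀ U U' : L → Matrix.specialUnitaryGroup (Fin N) ℂ,
        ‖P (coeConfig U) - P (coeConfig U')‖ ≤ KF * ‖coeConfig U - coeConfig U'‖ := by
  obtain ⟨B, hB0, hB⟩ := exists_bound_on_closedBall_of_continuous hP.continuous (N : ℝ)
  obtain ⟨K, hK0, hK⟩ := exists_lipschitz_on_closedBall_of_contDiff hP (N : ℝ)
  have hmem : ∀ U : L → Matrix.specialUnitaryGroup (Fin N) ℂ,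
      coeConfig U ∈ closedBall (0 : L → Matrix (Fin N) (Fin N) ℂ) N := fun U => by
    rw [mem_closedBall, dist_zero_right]
    simpa only [Fintype.card_fin] using norm_coeConfig_le U
  exact ⟨B, K, hB0, hK0, fun U l => (norm_le_pi_norm _ l).trans (hB _ (hmem U)),
    fun U U' => hK _ (hmem U) _ (hmem U')⟩

variable [MeasurableSpace E] [BorelSpace E]

omit [NormedSpace ℝ E] in
/-- The force `U ↦ P (coeConfig U)` of a continuous ambient law is measurable (`coeConfig` is continuous). -/
theorem measurable_sunForce_of_continuous (P : (L → Matrix (Fin N) (Fin N) ℂ) → L → E) (hP : Continuous P) :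
    Measurable fun U : L → Matrix.specialUnitaryGroup (Fin N) ℂ => P (coeConfig U) :=
  have hc : Continuous (coeConfig (n := Fin N) (L := L)) :=
    continuous_pi fun l => continuous_subtype_val.comp (continuous_apply l)
  measurable_pi_lambda _ fun l => ((continuous_apply l).comp (hP.comp hc)).measurable

end Config

/-! ## §3 The engine's multi-step HMC converges for short trajectories with every smooth force law -/

section Engine

variable (N : ℕ) [NeZero N] {L : Type*} [Fintype L]
  {S : (L → Matrix.specialUnitaryGroup (Fin N) ℂ) → ℝ} {s : ℝ}

/-- **THE ENGINE'S `n`-STEP LEAPFROG HMC WITH ANY `C¹` FORCE LAW, IN TRAJECTORY-LENGTH FORM.**  For every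
`C¹` ambient law `P : (links → M_N(ℂ)) → (links → coordinates)` and every measurable action bounded by
`s` there is `τ₀ > 0` such that for EVERY `n ≥ 1` and `ε > 0` with `nε ≤ τ₀` the engine's `n`-step
leapfrog HMC (coordinates `sunCoordι N`, kinetic term `−Σ tr P²`, Gaussian refresh, half kick
`−(ε/2)·P(U)`, Metropolis test) converges to `Z_S⁻¹e^{−S}·Haar^{⊗links}` from every initial law,
geometrically in total variation. -/
theorem engine_sunLeapfrogHMCN_uniformlyErgodic_of_contDiff
    (P : (L → Matrix (Fin N) (Fin N) ℂ) → L → SUNCoords N) (hP : ContDiff ℝ 1 P)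
    (hS : Measurable S) (hs : ∀ u, |S u| ≤ s) :
    ∃ τ₀ : ℝ, 0 < τ₀ ∧ ∀ (nstep : ℕ) (ε : ℝ) (hn : 1 ≤ nstep) (hε : 0 < ε), nstep * ε ≤ τ₀ →
      ∃ k : ℕ, ∃ δ : ℝ, 0 < δ ∧ δ ≤ 1 ∧ ∀ (μ₀ : Measure (L → Matrix.specialUnitaryGroup (Fin N) ℂ))
        [IsProbabilityMeasure μ₀] (t : ℕ) (A : Set (L → Matrix.specialUnitaryGroup (Fin N) ℂ)),
        |((fun m : Measure (L → Matrix.specialUnitaryGroup (Fin N) ℂ) =>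
              m.bind (sunLeapfrogHMCN (sunCoordι N) (sunCoordι_skew N) ε (Measure.addHaar : Measure (SUNCoords N))
                (sunKinetic N)
                (measurable_halfKick_sun N (measurable_sunForce_of_continuous P hP.continuous) ε) S nstep))^[t] μ₀).real A
            - (gibbsProbability (Measure.pi fun _ : L => haarProbability (Matrix.specialUnitaryGroup (Fin N) ℂ))
                (fun u => Real.exp (-S u))).real A| ≤ (1 - δ) ^ (t / (k + 1)) := by
  obtain ⟨Fmax, KF, hF0, hK0, hFb, hFK⟩ := sunForce_bounds_of_contDiff P hP
  exact engine_sunLeapfrogHMCN_uniformlyErgodic_of_trajLength N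
    (measurable_sunForce_of_continuous P hP.continuous) hF0 hFb hK0 hFK hS hs

/-- **… and in the same regime `Z_S⁻¹e^{−S}·Haar^{⊗links}` is the ONLY invariant probability law** of the
engine's `n`-step leapfrog HMC with the `C¹` force law `P` (`nε ≤ τ₀`, the same `τ₀`). -/
theorem engine_sunLeapfrogHMCN_invariant_unique_of_contDiff
    (P : (L → Matrix (Fin N) (Fin N) ℂ) → L → SUNCoords N) (hP : ContDiff ℝ 1 P)
    (hS : Measurable S) (hs : ∀ u, |S u| ≤ s) :
    ∃ τ₀ : ℝ, 0 < τ₀ ∧ ∀ (nstep : ℕ) (ε : ℝ) (hn : 1 ≤ nstep) (hε : 0 < ε), nstep * ε ≤ τ₀ →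
      ∀ (π' : Measure (L → Matrix.specialUnitaryGroup (Fin N) ℂ)), IsProbabilityMeasure π' →
        Invariant (sunLeapfrogHMCN (sunCoordι N) (sunCoordι_skew N) ε (Measure.addHaar : Measure (SUNCoords N))
          (sunKinetic N) (measurable_halfKick_sun N (measurable_sunForce_of_continuous P hP.continuous) ε) S nstep) π' →
        π' = gibbsProbability (Measure.pi fun _ : L => haarProbability (Matrix.specialUnitaryGroup (Fin N) ℂ))
          (fun u => Real.exp (-S u)) := by
  obtain ⟨Fmax, KF, hF0, hKF0, hFb, hFK⟩ := sunForce_bounds_of_contDiff P hP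
  set s₀ := sunShortTrajThreshold (sunCoordι N) (sunCoordι_injective N) with hs₀
  have hs₀0 : 0 < s₀ := sunShortTrajThreshold_pos _ _
  refine ⟨min s₀ (min (s₀ / (3 * Fmax + 1)) (Real.sqrt (s₀ / (KF + 1)))),
    lt_min hs₀0 (lt_min (by positivity) (Real.sqrt_pos.2 (by positivity))),
    fun nstep ε hn hε hτ π' hπ' hinv => ?_⟩
  obtain ⟨h1, h2, h3⟩ := trajLength_threshold_arith hs₀0 hF0 hKF0 hn hε rfl hτ
  haveI := hπ'
  refine engine_sunLeapfrogHMCN_invariant_unique N hε hn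
    (measurable_halfKick_sun N (measurable_sunForce_of_continuous P hP.continuous) ε) (b := ε / 2 * Fmax)
    (Kg := ε / 2 * KF) (by positivity) (fun U l => ?_) (by positivity) (fun U U' => ?_) hS hs h1 h2 h3 hinv
  · rw [Pi.smul_apply, norm_smul, Real.norm_eq_abs, abs_neg, abs_of_pos (by positivity)]
    exact mul_le_mul_of_nonneg_left (hFb U l) (by positivity)
  · have hsub : (-(ε / 2)) • P (coeConfig U) - (-(ε / 2)) • P (coeConfig U') =
        (-(ε / 2)) • (P (coeConfig U) - P (coeConfig U')) := by
      funext l; simp only [Pi.sub_apply, Pi.smul_apply, smul_sub]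
    rw [hsub, norm_smul, Real.norm_eq_abs, abs_neg, abs_of_pos (by positivity), mul_assoc]
    exact mul_le_mul_of_nonneg_left (hFK U U') (by positivity)

end Engine

end Summit.Ventures.LatticeQCDFlow.Exactness
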